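import Summits.Ventures.PercRepro.RankLevelSetExplicitCapArith
import Summits.Ventures.PercRepro.RankLevelSetLevelEightArithMult4A

/-!
# PercRepro — THE ARITHMETIC OF THEOREM P⁗, PART A: THE MULTIPLICITY THRESHOLD `Tmult q = q·2^{⌈5q/4⌉+2} + 5q·2^{q+2}`
AND THE GENERIC LEMMAS (p9, S4)

`proofs/SUBCLAIM-S4-p9.md` §S4.2‴. THEOREM P‴ (`RankLevelSetExplicitCap`) bounds the fibre sums of night-1's split
count by `2^{d−1}` (the nullity cap) and the circuit sums through Vandermonde after factoring `3`; its threshold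
`(q + 2)·2^{2q+6}` comes from the `k = 3` term `C(d+q, 3)·C(n, q−2)` at the top corank `d = q + 2^q`. Three levers,
each a kernel theorem of the tree, lower the exponent from `2q` to `⌈5q/4⌉`:
* the MULTIPLICITY count (`ncard_eRk_eq_ncard_eq_mul_le`, DepCountMult): the fibre weights become
  `Σ_{j < d−q} C(F, j)/(j+1) ≤ (2^{F+1} − 1)/(F+1)` (`sum_range_choose_div_succ_le`) — a factor `1/(F+1)`;
* LOCAL SPARSITY in the small class: the weight index is `F′ + 1 = min (2^{q−1} − q) d` (rank-`≤ q−1` sets have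
  `≤ 2^{q−1} − 1` points), so the small-class weight is `≤ 2^d / min (2^{q−1} − q) d` at every corank;
* LEMMA T and LEMMA T4 (`2s₃ ≤ d(d+1)`, `3s₄ ≤ d(d+1)(d+2)`) for the two leading circuit counts, Vandermonde after
  factoring `5` for the rest (`circuit_sum_le_vandermonde_five`).
The polynomial inequality `(P_d)` then reads `8·(C(n,q) + W_s·A + W_b·B) ≤ 7·2^{d−q}·C(p+q,q)` with
`W_s·μ ≤ 2^d`, `W_b·d ≤ 2^d`, `6A ≤ 3d(d+1)·C(n,q−2) + 2d(d+1)(d+2)·C(n,q−3) + 6·C(d+q,5)·C(d+q−5+n, q−4)` and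
`B ≤ C(d+q,3)·C(d+q−3+(q+1)d, q−2)`; it holds for every corank `q + 1 ≤ d ≤ q + 2^q` as soon as `p ≥ Tmult q`
(`poly_main_mult`, Part B): `Tmult 4 = 1 792`, `Tmult 5 = 5 760`, `Tmult 6 = 13 824`, `Tmult 7 = 32 256`, `Tmult 8 = 73 728`,
`Tmult 10 = 532 480`, `Tmult 20 ≈ 3.1·10^9` — against `Tcap 7 = 9 437 184`, `Tcap 8 = 41 943 040`, `Tcap 20 ≈ 1.5·10^15`.
Exact-integer twin: lean-drafts/p9/g3/checks/twin_mult.py (every corank, `q ≤ 13`, 0 failures). Axioms: standard.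
-/

namespace PercRepro

namespace ThmN

namespace Explicit

/-- **The multiplicity threshold** `Tmult q = q·2^{⌈5q/4⌉+2} + 5q·2^{q+2}` (`⌈5q/4⌉ = (5q+3)/4`). -/
def Tmult (q : ℕ) : ℕ := q * 2 ^ ((5 * q + 3) / 4 + 2) + 5 * q * 2 ^ (q + 2)

/-- The regime thresholds below `Tmult q` (`q ≥ 4`): `N₁ q`, `16q·2^q`, `3(2q + 2^q) + 5`, `20q·2^q`,
`q·2^{⌈5q/4⌉+2}`, `6(q+2)·2^q`. -/
theorem Tmult_bounds (q : ℕ) (hq : 4 ≤ q) :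
    2 ^ (q + 1) + 2 * q ^ 2 + 4 * q + 4 ≤ Tmult q ∧ 16 * q * 2 ^ q ≤ Tmult q ∧ 3 * (2 * q + 2 ^ q) + 5 ≤ Tmult q ∧
      20 * q * 2 ^ q ≤ Tmult q ∧ q * 2 ^ ((5 * q + 3) / 4 + 2) ≤ Tmult q ∧ 6 * (q + 2) * 2 ^ q ≤ Tmult q := by
  unfold Tmult
  have hx := succ_le_two_pow q
  have h4 : 2 ^ (q + 2) = 4 * 2 ^ q := by rw [pow_add]; ring
  have h1 : 2 ^ (q + 1) = 2 * 2 ^ q := by rw [pow_add]; ring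
  rw [h4, h1]
  have h0 : 0 ≤ q * 2 ^ ((5 * q + 3) / 4 + 2) := Nat.zero_le _
  refine ⟨?_, ?_, ?_, ?_, ?_, ?_⟩ <;> nlinarith

/-- `Tmult` grows: `Tmult q + 1 ≤ Tmult (q + 1)`. -/
theorem Tmult_succ_le (q : ℕ) : Tmult q + 1 ≤ Tmult (q + 1) := by
  unfold Tmult
  have he : (5 * q + 3) / 4 + 2 ≤ (5 * (q + 1) + 3) / 4 + 2 := by omega
  have h1 : 2 ^ ((5 * q + 3) / 4 + 2) ≤ 2 ^ ((5 * (q + 1) + 3) / 4 + 2) := Nat.pow_le_pow_right (by norm_num) he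
  have h2 : 2 ^ (q + 2) ≤ 2 ^ (q + 1 + 2) := Nat.pow_le_pow_right (by norm_num) (by omega)
  have h3 : 1 ≤ 2 ^ (q + 1 + 2) := Nat.one_le_two_pow
  have hb : 1 ≤ 2 ^ ((5 * (q + 1) + 3) / 4 + 2) := Nat.one_le_two_pow
  have ha := Nat.mul_le_mul (le_refl q) h1
  have hc := Nat.mul_le_mul (le_refl (5 * q)) h2
  nlinarith [ha, hc, hb, h3]

/-- `3^q ≥ 5·2^q` for `q ≥ 4`. -/
theorem five_mul_two_pow_le_three_pow (q : ℕ) (hq : 4 ≤ q) : 5 * 2 ^ q ≤ 3 ^ q := by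
  induction q, hq using Nat.le_induction with
  | base => norm_num
  | succ q _ ih => rw [pow_succ, pow_succ]; omega

/-- `C(n, q) ≤ 2·C(p+q, q)` for `n = p + q + 1 + m` and `2q(m+1) ≤ p + 1` (the second half of `ratio_bounds`,
without the `16q(m+1)` side condition). -/
theorem choose_le_two_mul_choose (q m p : ℕ) (h2qm : 2 * q * (m + 1) ≤ p + 1) :
    (p + q + 1 + m).choose q ≤ 2 * (p + q).choose q := by
  have hR := choose_mul_pow_le_choose_mul_pow p q (q + 1 + m) (by omega)
  rw [show q + 1 + m - q = m + 1 by omega, show p + (q + 1 + m) = p + q + 1 + m by omega] at hR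
  have hB := add_pow_mul_le_pow_mul (p + 1) (m + 1) q h2qm
  have hpos : 0 < (p + 1) ^ q := by positivity
  have hp1 : 0 < p + 1 := by omega
  have h1 : (p + q + 1 + m).choose q * (p + 1) ≤ (p + q).choose q * (p + 1 + 2 * q * (m + 1)) := by
    apply Nat.le_of_mul_le_mul_left _ hpos
    calc (p + 1) ^ q * ((p + q + 1 + m).choose q * (p + 1))
        = ((p + q + 1 + m).choose q * (p + 1) ^ q) * (p + 1) := by ring
      _ ≤ ((p + q).choose q * (p + 1 + (m + 1)) ^ q) * (p + 1) := Nat.mul_le_mul_right _ hR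
      _ = (p + q).choose q * ((p + 1 + (m + 1)) ^ q * (p + 1)) := by ring
      _ ≤ (p + q).choose q * ((p + 1) ^ q * (p + 1 + 2 * q * (m + 1))) := Nat.mul_le_mul_left _ hB
      _ = (p + 1) ^ q * ((p + q).choose q * (p + 1 + 2 * q * (m + 1))) := by ring
  apply Nat.le_of_mul_le_mul_right _ hp1
  calc (p + q + 1 + m).choose q * (p + 1) ≤ (p + q).choose q * (p + 1 + 2 * q * (m + 1)) := h1
    _ ≤ (p + q).choose q * (2 * (p + 1)) := Nat.mul_le_mul_left _ (by omega)
    _ = 2 * (p + q).choose q * (p + 1) := by ring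

/-- One level down: `p·C(n, k) ≤ (k+1)·C(n, k+1)` when `p + k ≤ n`. -/
theorem choose_mul_le_succ_mul_choose (n k p : ℕ) (h : p + k ≤ n) :
    p * n.choose k ≤ (k + 1) * n.choose (k + 1) := by
  have h1 := Nat.choose_succ_right_eq n k
  calc p * n.choose k ≤ (n - k) * n.choose k := Nat.mul_le_mul_right _ (by omega)
    _ = n.choose (k + 1) * (k + 1) := by rw [mul_comm, h1]
    _ = (k + 1) * n.choose (k + 1) := by ring

/-- `j` levels down: `p^j·C(n, k) ≤ (k+j)^{\underline j}·C(n, k+j)` when `p + k + j ≤ n + 1`. -/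
theorem pow_mul_choose_le_descFactorial_mul_choose (n k p : ℕ) :
    ∀ j, p + k + j ≤ n + 1 → p ^ j * n.choose k ≤ (k + j).descFactorial j * n.choose (k + j) := by
  intro j
  induction j with
  | zero => intro _; simp
  | succ j ih =>
    intro hj
    have h1 := ih (by omega)
    have h2 := choose_mul_le_succ_mul_choose n (k + j) p (by omega)
    rw [show k + (j + 1) = k + j + 1 by omega, Nat.succ_descFactorial_succ]
    calc p ^ (j + 1) * n.choose k = p * (p ^ j * n.choose k) := by ring
      _ ≤ p * ((k + j).descFactorial j * n.choose (k + j)) := Nat.mul_le_mul_left _ h1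
      _ = (k + j).descFactorial j * (p * n.choose (k + j)) := by ring
      _ ≤ (k + j).descFactorial j * ((k + j + 1) * n.choose (k + j + 1)) := Nat.mul_le_mul_left _ h2
      _ = (k + j + 1) * (k + j).descFactorial j * n.choose (k + j + 1) := by ring

/-- Two levels down at `n = p + q`: `p²·C(p+q, q−2) ≤ q(q−1)·C(p+q, q)` (`q ≥ 2`). -/
theorem two_down (p q : ℕ) (hq : 2 ≤ q) :
    p ^ 2 * (p + q).choose (q - 2) ≤ q * (q - 1) * (p + q).choose q := by
  have h := pow_mul_choose_le_descFactorial_mul_choose (p + q) (q - 2) p 2 (by omega)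
  rw [show q - 2 + 2 = q by omega] at h
  have e : q.descFactorial 2 = q * (q - 1) := by
    obtain ⟨r, rfl⟩ : ∃ r, q = r + 2 := ⟨q - 2, by omega⟩
    simp [Nat.descFactorial]
    ring
  rw [e] at h
  exact h

/-- Three levels down at `n = p + q`: `p³·C(p+q, q−3) ≤ q(q−1)(q−2)·C(p+q, q)` (`q ≥ 3`). -/
theorem three_down (p q : ℕ) (hq : 3 ≤ q) :
    p ^ 3 * (p + q).choose (q - 3) ≤ q * (q - 1) * (q - 2) * (p + q).choose q := by
  have h := pow_mul_choose_le_descFactorial_mul_choose (p + q) (q - 3) p 3 (by omega)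
  rw [show q - 3 + 3 = q by omega] at h
  have e : q.descFactorial 3 = q * (q - 1) * (q - 2) := by
    obtain ⟨r, rfl⟩ : ∃ r, q = r + 3 := ⟨q - 3, by omega⟩
    simp [Nat.descFactorial]
    ring
  rw [e] at h
  exact h

/-- Four levels down at `n = p + q`: `p⁴·C(p+q, q−4) ≤ q(q−1)(q−2)(q−3)·C(p+q, q)` (`q ≥ 4`). -/
theorem four_down (p q : ℕ) (hq : 4 ≤ q) :
    p ^ 4 * (p + q).choose (q - 4) ≤ q * (q - 1) * (q - 2) * (q - 3) * (p + q).choose q := by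
  have h := pow_mul_choose_le_descFactorial_mul_choose (p + q) (q - 4) p 4 (by omega)
  rw [show q - 4 + 4 = q by omega] at h
  have e : q.descFactorial 4 = q * (q - 1) * (q - 2) * (q - 3) := by
    obtain ⟨r, rfl⟩ : ∃ r, q = r + 4 := ⟨q - 4, by omega⟩
    simp [Nat.descFactorial]
    ring
  rw [e] at h
  exact h

/-- `C(a, k) ≤ C(a, 5)·C(a − 5, k − 5)` for `k ≥ 5`. -/
theorem choose_le_choose_five_mul (a k : ℕ) (hk : 5 ≤ k) :
    a.choose k ≤ a.choose 5 * (a - 5).choose (k - 5) := by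
  have hm := Nat.choose_mul (n := a) (k := k) (s := 5) hk
  have hpos : 1 ≤ k.choose 5 := Nat.choose_pos hk
  calc a.choose k ≤ a.choose k * k.choose 5 := Nat.le_mul_of_pos_right _ hpos
    _ = a.choose 5 * (a - 5).choose (k - 5) := hm

/-- **The circuit sum through Vandermonde after factoring `5`**: for `q ≥ 4`,
`Σ_{k ∈ [5, q+1]} C(d+k−1, k)·C(n, q+1−k) ≤ C(d+q, 5)·C(d+q−5+n, q−4)`. -/
theorem circuit_sum_le_vandermonde_five (q d n : ℕ) (hq : 4 ≤ q) :
    ∑ k ∈ Finset.Icc 5 (q + 1), (d + k - 1).choose k * n.choose (q + 1 - k) ≤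
      (d + q).choose 5 * (d + q - 5 + n).choose (q - 4) := by
  have h1 : ∀ k ∈ Finset.Icc 5 (q + 1), (d + k - 1).choose k * n.choose (q + 1 - k) ≤
      (d + q).choose 5 * ((d + q - 5).choose (k - 5) * n.choose (q + 1 - k)) := by
    intro k hk
    rw [Finset.mem_Icc] at hk
    have ha : (d + k - 1).choose k ≤ (d + q).choose k := Nat.choose_le_choose k (by omega)
    have hb := choose_le_choose_five_mul (d + q) k hk.1
    calc (d + k - 1).choose k * n.choose (q + 1 - k)
        ≤ ((d + q).choose 5 * (d + q - 5).choose (k - 5)) * n.choose (q + 1 - k) :=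
          Nat.mul_le_mul_right _ (ha.trans hb)
      _ = _ := by ring
  refine (Finset.sum_le_sum h1).trans ?_
  rw [← Finset.mul_sum]
  apply le_of_eq
  congr 1
  rw [Nat.add_choose_eq, Finset.Nat.sum_antidiagonal_eq_sum_range_succ_mk]
  rw [show Finset.Icc 5 (q + 1) = Finset.image (fun i => 5 + i) (Finset.range (q - 4).succ) from ?_]
  · rw [Finset.sum_image (fun a _ b _ h => by omega)]
    apply Finset.sum_congr rfl
    intro i _
    rw [show 5 + i - 5 = i by omega, show q + 1 - (5 + i) = q - 4 - i by omega]
  · ext k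
    simp only [Finset.mem_Icc, Finset.mem_image, Finset.mem_range]
    constructor
    · intro hk
      exact ⟨k - 5, by omega, by omega⟩
    · rintro ⟨i, hi, rfl⟩
      omega

/-- The sum over `[3, q+1]` splits off its first two terms (`q ≥ 4`). -/
theorem sum_Icc_three_split (q : ℕ) (hq : 4 ≤ q) (f : ℕ → ℕ) :
    ∑ k ∈ Finset.Icc 3 (q + 1), f k = f 3 + f 4 + ∑ k ∈ Finset.Icc 5 (q + 1), f k := by
  have e : Finset.Icc 3 (q + 1) = insert 3 (insert 4 (Finset.Icc 5 (q + 1))) := by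
    ext k
    simp only [Finset.mem_Icc, Finset.mem_insert]
    omega
  rw [e, Finset.sum_insert, Finset.sum_insert]
  · ring
  · simp only [Finset.mem_Icc]; omega
  · simp only [Finset.mem_insert, Finset.mem_Icc]; omega

/-- `120·C(a, 5) ≤ a^5`. -/
theorem choose_five_mul_le (a : ℕ) : 120 * a.choose 5 ≤ a ^ 5 := by
  have h1 := Nat.descFactorial_eq_factorial_mul_choose a 5
  have h2 := Nat.descFactorial_le_pow a 5
  rw [h1] at h2
  simpa [Nat.factorial] using h2

/-- `6·C(a, 3) ≤ a^3`. -/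
theorem choose_three_mul_le (a : ℕ) : 6 * a.choose 3 ≤ a ^ 3 := by
  have h1 := Nat.descFactorial_eq_factorial_mul_choose a 3
  have h2 := Nat.descFactorial_le_pow a 3
  rw [h1] at h2
  simpa [Nat.factorial] using h2

/-- `(q−2)!·C(X, q−2) ≤ X^{q−2}` and `q! = q(q−1)·(q−2)!` combined: `q!·C(X, q−2) ≤ q(q−1)·X^{q−2}` (`q ≥ 2`). -/
theorem factorial_mul_choose_sub_two_le (X q : ℕ) (hq : 2 ≤ q) :
    q.factorial * X.choose (q - 2) ≤ q * (q - 1) * X ^ (q - 2) := by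
  obtain ⟨r, rfl⟩ : ∃ r, q = r + 2 := ⟨q - 2, by omega⟩
  rw [show r + 2 - 2 = r by omega, show r + 2 - 1 = r + 1 by omega]
  have h1 := Nat.descFactorial_eq_factorial_mul_choose X r
  have h2 := Nat.descFactorial_le_pow X r
  rw [h1] at h2
  calc (r + 2).factorial * X.choose r = (r + 2) * (r + 1) * (r.factorial * X.choose r) := by
        rw [Nat.factorial_succ, Nat.factorial_succ]; ring
    _ ≤ (r + 2) * (r + 1) * X ^ r := Nat.mul_le_mul_left _ h2


/-- The facts about `x = 2^q`, `y = 2^{q−1}`, `z = 2^{q−2}` used below (`q ≥ 4`): `2y = x`, `4z = x`, `q + 1 ≤ y`,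
`q ≤ z`. -/
theorem two_pow_facts (q : ℕ) (hq : 4 ≤ q) :
    2 * 2 ^ (q - 1) = 2 ^ q ∧ 4 * 2 ^ (q - 2) = 2 ^ q ∧ q + 1 ≤ 2 ^ (q - 1) ∧ q ≤ 2 ^ (q - 2) := by
  obtain ⟨r, rfl⟩ : ∃ r, q = r + 4 := ⟨q - 4, by omega⟩
  simp only [show r + 4 - 1 = r + 3 by omega, show r + 4 - 2 = r + 2 by omega]
  have hr := succ_le_two_pow r
  have e3 : 2 ^ (r + 3) = 8 * 2 ^ r := by rw [pow_add]; ring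
  have e2 : 2 ^ (r + 2) = 4 * 2 ^ r := by rw [pow_add]; ring
  refine ⟨by ring, by ring, ?_, ?_⟩
  · rw [e3]; omega
  · rw [e2]; omega

/-- `p ≥ Tmult q` gives `p ≥ 20q·2^q`, hence `p² ≥ 400q²x²`, `p³ ≥ 8000q³x³` (`x = 2^q`), and `p ≥ 1`. -/
theorem p_pow_bounds (q p : ℕ) (hq : 4 ≤ q) (hp : Tmult q ≤ p) :
    400 * q ^ 2 * (2 ^ q) ^ 2 ≤ p ^ 2 ∧ 8000 * q ^ 3 * (2 ^ q) ^ 3 ≤ p ^ 3 ∧ 1 ≤ p := by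
  obtain ⟨-, -, -, h20, -, -⟩ := Tmult_bounds q hq
  have h : 20 * q * 2 ^ q ≤ p := h20.trans hp
  refine ⟨?_, ?_, ?_⟩
  · calc 400 * q ^ 2 * (2 ^ q) ^ 2 = (20 * q * 2 ^ q) ^ 2 := by ring
      _ ≤ p ^ 2 := Nat.pow_le_pow_left h 2
  · calc 8000 * q ^ 3 * (2 ^ q) ^ 3 = (20 * q * 2 ^ q) ^ 3 := by ring
      _ ≤ p ^ 3 := Nat.pow_le_pow_left h 3
  · have : 1 ≤ 2 ^ q := Nat.one_le_two_pow
    nlinarith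

/-- `p ≥ Tmult q` gives `p⁴ ≥ 256·q⁴·(2^q)^5` (from `p ≥ q·2^{⌈5q/4⌉+2}` and `4⌈5q/4⌉ ≥ 5q`). -/
theorem p_pow_four_bound (q p : ℕ) (hq : 4 ≤ q) (hp : Tmult q ≤ p) :
    256 * q ^ 4 * (2 ^ q) ^ 5 ≤ p ^ 4 := by
  obtain ⟨-, -, -, -, hE, -⟩ := Tmult_bounds q hq
  have h : q * 2 ^ ((5 * q + 3) / 4 + 2) ≤ p := hE.trans hp
  have hexp : 5 * q + 8 ≤ 4 * ((5 * q + 3) / 4 + 2) := by omega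
  have h1 : 2 ^ (5 * q + 8) ≤ 2 ^ (4 * ((5 * q + 3) / 4 + 2)) := Nat.pow_le_pow_right (by norm_num) hexp
  calc 256 * q ^ 4 * (2 ^ q) ^ 5 = q ^ 4 * 2 ^ (5 * q + 8) := by
        rw [pow_add, ← pow_mul]; ring
    _ ≤ q ^ 4 * 2 ^ (4 * ((5 * q + 3) / 4 + 2)) := Nat.mul_le_mul_left _ h1
    _ = (q * 2 ^ ((5 * q + 3) / 4 + 2)) ^ 4 := by rw [mul_pow, ← pow_mul]; ring_nf
    _ ≤ p ^ 4 := Nat.pow_le_pow_left h 4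

end Explicit

end ThmN

end PercRepro
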